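import Literature.AlgebraicTopology.SingularHomology.TransverseDiscFunctionalComparison
import Literature.AlgebraicTopology.SingularHomology.RelClassSignConstancy
import HarnessLib

/-!
# The incidence of a relative class along a Euclidean chart is constant (Hatcher 2002, §3.3,
# Lemma 3.27; Milnor 1965, completion of the proof of Thm. 7.6, PDF p. 52)

Topic `Literature/AlgebraicTopology/SingularHomology`; a brick for the last hypothesis `HSgn` of
Milnor's Basis Theorem 7.6 on a slab
(`Literature.Topology.FourManifolds.Cobordism.Milnor1965_basisTheorem_slab_of_crossingSign`;
named fact `Literature.Topology.FourManifolds.Cobordism.Milnor1965_basisTheorem_slab`).  The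
value of the transverse disc functional of `D_R(p₂)` on the slid disc `D_L'(p₁)` is
`(a · sign det L) • w₀` (`TransverseDiscDatum.functional_map_eq_smul_of_single`,
`TransverseDiscFunctionalRelative.lean`), `a` the *incidence* of the disc's class at the crossing
parameter `p⋆` of the Euclidean crossing chart `e : V ≃ U ⊆ D_L'(p₁)`
(`TransverseDiscDatum.exists_incidence`: the localisation at `e c` is `a • (U ⊆ T)⁎ e⁎ g_c`).
To compare the two dockings the incidence must be read at another point of the same chart (at
a height above the band, where the two slid discs and their charts agree); this file proves that
it does not depend on the point:

* `exists_units_forall_toLocal_eq_incidence` — for `T` Hausdorff, `w ∈ Hₖ(T, B; ℤ)`, an open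
  `U ⊆ T ∖ B` with a Euclidean model `e : V ≃ U` over a preconnected open `V ⊆ ℝᵏ`, and `w|_u`
  a generator of `Hₖ(T | u)` for `u ∈ U`: there is ONE `ε = ±1` with
  `w|_{e c} = (U ⊆ T)⁎ (ε • e⁎ g_c)` for every `c ∈ V` — the hypothesis `hσ` of
  `functional_map_eq_smul_of_single` with the same `a = ε` at every chart point.

Proof: the family `c ↦ e⁎⁻¹ (w|_{e c}` excised to `U)` on `V` is consistent near every point
(`LocalFamily.ConsistentOn.preimage_of_isOpenEmbedding` along `U ⊆ T`, then transport along
`e` across universes with `localHomologyOfSet.xEquiv`, `localHomology.xEquiv_restrictToPoint`),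
the family `c ↦ g_c|_V` is consistent (excision along `V ⊆ ℝᵏ`), both generate, so they differ
by a locally constant sign (`LocalFamily.sign_eq_of_isPreconnected`).  Everything here is
proved; no definitions, no named facts.

## References

* A. Hatcher, *Algebraic Topology*, CUP 2002, Thm. 2.20, §3.3 pp. 231–236, Lemma 3.27.
  [HatcherAT2002]
* J. Milnor, *Lectures on the h-cobordism theorem*, Princeton Mathematical Notes (1965),
  completion of the proof of Thm. 7.6 (PDF p. 52).  Held:
  `lit read book:milnornd-lectures-h-cobordism-theorem`. [MilnorHCobordism1965]
-/

noncomputable section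

open CategoryTheory Set Function Filter Topology

universe u

namespace Literature.AlgebraicTopology.SingularHomology

/-- **The incidence of a relative class along a Euclidean chart is constant.**  Let `T` be
Hausdorff, `B ⊆ T`, `w ∈ Hₖ(T, B; ℤ)`, `U ⊆ T ∖ B` open with a Euclidean model `e : V ≃ U`,
`V ⊆ ℝᵏ` open and preconnected, `g` an orientation of `ℝᵏ`, and suppose `w|_u` generates
`Hₖ(T | u)` for every `u ∈ U`.  Then for one `ε = ±1` and every `c ∈ V`, the localisation of
`w` at `e c` is `(U ⊆ T)⁎ (ε • e⁎ (g_c|_V))` (hypothesis `hσ` of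
`TransverseDiscDatum.functional_map_eq_smul_of_single`, with the incidence `a = ε` at every
point of the chart). [cite: HatcherAT2002, §3.3 pp. 233–236, Lemma 3.27; MilnorHCobordism1965, proof of Thm. 7.6 (PDF p. 52)] -/
theorem exists_units_forall_toLocal_eq_incidence {k : ℕ}
    (g : HomologicalOrientation ℤ (EuclideanSpace ℝ (Fin k)) k)
    {T : Type u} [TopologicalSpace T] [T2Space T] {B U : Set T} (hU : IsOpen U) (hUB : U ⊆ Bᶜ)
    {V : Set (EuclideanSpace ℝ (Fin k))} (hV : IsOpen V) (hVc : IsPreconnected V)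
    (e : ↥V ≃ₜ ↥U) (w : relativeSingularHomology ℤ ℤ T B k)
    (hgen : ∀ u : ↥U, ∃ f : localHomology ℤ ℤ T (u : T) k ≃ₗ[ℤ] ℤ, f (relLocalFamily w (u : T)) = 1) :
    ∃ ε : ℤˣ, ∀ (c : ↥V) (hB : MapsTo (ContinuousMap.id T) B ({((e c : ↥U) : T)}ᶜ : Set T)),
      relativeSingularHomology.map ℤ ℤ (ContinuousMap.id T) hB k w =
        relativeSingularHomology.map ℤ ℤ (subsetIncl U)
          (localHomology.mapsTo_subsetIncl_compl (e c).2) k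
          ((ε : ℤ) • localHomology.xEquiv ℤ ℤ e c k
            ((localHomology.openSubsetIso ℤ ℤ hV c.2 k).inv (g.localClass (c : EuclideanSpace ℝ (Fin k))))) := by
  classical
  -- the model families on `V`: `β c = g_c|_V`, `β' c = e⁎⁻¹ (w|_{e c}` excised to `U)`
  set β : LocalFamily ℤ ℤ ↥V k := fun c =>
    (localHomology.openSubsetIso ℤ ℤ hV c.2 k).inv (g.localClass (c : EuclideanSpace ℝ (Fin k))) with hβ
  set βU : LocalFamily ℤ ℤ ↥U k := fun u =>
    (localHomology.openSubsetIso ℤ ℤ hU u.2 k).inv (relLocalFamily w (u : T)) with hβU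
  set β' : LocalFamily ℤ ℤ ↥V k := fun c => (localHomology.xEquiv ℤ ℤ e c k).symm (βU (e c)) with hβ'
  -- the open embeddings `V ⊆ ℝᵏ`, `U ⊆ T`; their push-forwards are the excision isomorphisms
  have hjV : IsOpenEmbedding (subsetIncl V : C(↥V, EuclideanSpace ℝ (Fin k))) := hV.isOpenEmbedding_subtypeVal
  have hjU : IsOpenEmbedding (subsetIncl U : C(↥U, T)) := hU.isOpenEmbedding_subtypeVal
  have hmapV : ∀ c : ↥V, relativeSingularHomology.map ℤ ℤ (subsetIncl V : C(↥V, EuclideanSpace ℝ (Fin k)))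
      (LocalFamily.mapsTo_compl_pt hjV.injective c) k = (localHomology.openSubsetIso ℤ ℤ hV c.2 k).hom :=
    fun c => rfl
  have hmapU : ∀ u : ↥U, relativeSingularHomology.map ℤ ℤ (subsetIncl U : C(↥U, T))
      (LocalFamily.mapsTo_compl_pt hjU.injective u) k = (localHomology.openSubsetIso ℤ ℤ hU u.2 k).hom :=
    fun u => rfl
  have hβj : ∀ c : ↥V, g.localClass ((subsetIncl V : C(↥V, EuclideanSpace ℝ (Fin k))) c) =
      relativeSingularHomology.map ℤ ℤ (subsetIncl V : C(↥V, EuclideanSpace ℝ (Fin k)))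
        (LocalFamily.mapsTo_compl_pt hjV.injective c) k (β c) := by
    intro c
    rw [hmapV c]
    show g.localClass (c : EuclideanSpace ℝ (Fin k)) = (localHomology.openSubsetIso ℤ ℤ hV c.2 k).hom
      ((localHomology.openSubsetIso ℤ ℤ hV c.2 k).inv (g.localClass (c : EuclideanSpace ℝ (Fin k))))
    rw [← ModuleCat.comp_apply, Iso.inv_hom_id, ModuleCat.id_apply]
  have hβUj : ∀ u : ↥U, relLocalFamily w ((subsetIncl U : C(↥U, T)) u) =
      relativeSingularHomology.map ℤ ℤ (subsetIncl U : C(↥U, T))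
        (LocalFamily.mapsTo_compl_pt hjU.injective u) k (βU u) := by
    intro u
    rw [hmapU u]
    show relLocalFamily w (u : T) = (localHomology.openSubsetIso ℤ ℤ hU u.2 k).hom
      ((localHomology.openSubsetIso ℤ ℤ hU u.2 k).inv (relLocalFamily w (u : T)))
    rw [← ModuleCat.comp_apply, Iso.inv_hom_id, ModuleCat.id_apply]
  -- local compactness of the pieces
  letI : ChartedSpace (EuclideanSpace ℝ (Fin k)) ↥V :=
    inferInstanceAs (ChartedSpace (EuclideanSpace ℝ (Fin k)) (⟨V, hV⟩ : TopologicalSpace.Opens _))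
  haveI : LocallyCompactSpace ↥V := ChartedSpace.locallyCompactSpace (EuclideanSpace ℝ (Fin k)) ↥V
  haveI : LocallyCompactSpace ↥U := e.symm.isOpenEmbedding.locallyCompactSpace
  -- `β` is consistent near every point (excision along `V ⊆ ℝᵏ`)
  have hβcons : ∀ c : ↥V, ∃ N ∈ 𝓝 c, β.ConsistentOn N := by
    intro c
    obtain ⟨N₀, hN₀, hN₀μ⟩ := g.consistentOn_nhds (c : EuclideanSpace ℝ (Fin k))
    have hpre : (Subtype.val ⁻¹' N₀ : Set ↥V) ∈ 𝓝 c :=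
      continuous_subtype_val.continuousAt.preimage_mem_nhds hN₀
    obtain ⟨K, hK, hKsub, hKcpt⟩ := local_compact_nhds hpre
    refine ⟨K, hK, ?_⟩
    have himg : IsCompact ((subsetIncl V : C(↥V, EuclideanSpace ℝ (Fin k))) '' K) :=
      hKcpt.image continuous_subtype_val
    have hcl : closure ((subsetIncl V : C(↥V, EuclideanSpace ℝ (Fin k))) '' K) ⊆
        range (subsetIncl V : C(↥V, EuclideanSpace ℝ (Fin k))) := by
      rw [himg.isClosed.closure_eq]
      rintro _ ⟨c', -, rfl⟩
      exact ⟨c', rfl⟩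
    have hsub : (subsetIncl V : C(↥V, EuclideanSpace ℝ (Fin k))) '' K ⊆ N₀ := by
      rintro _ ⟨c', hc', rfl⟩
      exact hKsub hc'
    exact LocalFamily.ConsistentOn.preimage_of_isOpenEmbedding (subsetIncl V) hjV hcl (hN₀μ.mono hsub)
      (fun c' _ => hβj c')
  -- `βU` is consistent near every point (excision along `U ⊆ T`)
  have hβUcons : ∀ u : ↥U, ∃ N ∈ 𝓝 u, βU.ConsistentOn N := by
    intro u
    obtain ⟨K, hKc, hKu⟩ := exists_compact_mem_nhds u
    refine ⟨K, hKu, ?_⟩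
    have himg : IsCompact ((subsetIncl U : C(↥U, T)) '' K) := hKc.image (subsetIncl U).continuous
    have hcl : closure ((subsetIncl U : C(↥U, T)) '' K) ⊆ range (subsetIncl U : C(↥U, T)) := by
      rw [himg.isClosed.closure_eq]
      rintro _ ⟨v, -, rfl⟩
      exact ⟨v, rfl⟩
    have hKB : (subsetIncl U : C(↥U, T)) '' K ⊆ Bᶜ := by
      rintro _ ⟨v, -, rfl⟩
      exact hUB v.2
    exact LocalFamily.ConsistentOn.preimage_of_isOpenEmbedding (subsetIncl U : C(↥U, T)) hjU hcl
      (consistentOn_relLocalFamily w hKB) (fun v _ => hβUj v)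
  -- `β'` is consistent near every point (transport along `e` across universes)
  have hβ'cons : ∀ c : ↥V, ∃ N ∈ 𝓝 c, β'.ConsistentOn N := by
    intro c
    obtain ⟨N, hN, m, hm⟩ := hβUcons (e c)
    refine ⟨e ⁻¹' N, e.continuous.continuousAt.preimage_mem_nhds hN,
      (localHomologyOfSet.xEquiv ℤ ℤ e (e ⁻¹' N) k).symm
        (restrictLocal ℤ ℤ (image_preimage_subset e N) k m), fun c' hc' => ?_⟩
    apply (localHomology.xEquiv ℤ ℤ e c' k).injective
    rw [localHomology.xEquiv_restrictToPoint, LinearEquiv.apply_symm_apply, restrictToPoint,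
      ← ModuleCat.comp_apply, restrictLocal_comp]
    rw [hβ']
    simp only [LinearEquiv.apply_symm_apply]
    exact hm (e c') hc'
  -- generators
  have hβgen : ∀ c : ↥V, ∃ f : localHomology ℤ ℤ ↥V c k ≃ₗ[ℤ] ℤ, f (β c) = 1 := by
    intro c
    obtain ⟨f, hf⟩ := g.isGenerator (c : EuclideanSpace ℝ (Fin k))
    refine ⟨(localHomology.openSubsetIso ℤ ℤ hV c.2 k).toLinearEquiv.trans f, ?_⟩
    rw [LinearEquiv.trans_apply, Iso.toLinearEquiv_apply]
    show f ((localHomology.openSubsetIso ℤ ℤ hV c.2 k).hom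
      ((localHomology.openSubsetIso ℤ ℤ hV c.2 k).inv (g.localClass (c : EuclideanSpace ℝ (Fin k))))) = 1
    rw [← ModuleCat.comp_apply, Iso.inv_hom_id, ModuleCat.id_apply, hf]
  have hβUgen : ∀ u : ↥U, ∃ f : localHomology ℤ ℤ ↥U u k ≃ₗ[ℤ] ℤ, f (βU u) = 1 := fun u =>
    exists_linearEquiv_apply_eq_one_of_linearEquiv (localHomology.openSubsetIso ℤ ℤ hU u.2 k).symm.toLinearEquiv
      (hgen u)
  have hβ'gen : ∀ c : ↥V, ∃ f : localHomology ℤ ℤ ↥V c k ≃ₗ[ℤ] ℤ, f (β' c) = 1 := fun c =>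
    exists_linearEquiv_apply_eq_one_of_linearEquiv (localHomology.xEquiv ℤ ℤ e c k).symm (hβUgen (e c))
  -- pointwise signs, locally constant, hence constant on the preconnected `V`
  set ε : ↥V → ℤˣ := fun c => if β' c = β c then 1 else -1 with hεdef
  have hε : ∀ c ∈ (univ : Set ↥V), β' c = (ε c : ℤ) • β c := by
    intro c _
    by_cases h : β' c = β c
    · rw [hεdef]; simp only [h, if_true, Units.val_one, one_smul]
    · have h' : β' c = -β c := (eq_or_eq_neg_of_isGenerator (hβ'gen c) (hβgen c)).resolve_left h
      rw [hεdef]; simp only [h, if_false, Units.val_neg, Units.val_one, neg_one_zsmul]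
      exact h'
  have hε' : ∀ c ∈ (univ : Set ↥V), β' c =
      @HSMul.hSMul ℤ _ _ (@instHSMul ℤ _ Module.toDistribMulAction.toDistribSMul.toSMul) (ε c : ℤ) (β c) := by
    intro c hc
    exact (hε c hc).trans (int_smul_eq_zsmul _ _ _).symm
  have hpre : IsPreconnected (univ : Set ↥V) := by
    haveI := isPreconnected_iff_preconnectedSpace.1 hVc
    exact isPreconnected_univ
  have hconst : ∀ c c' : ↥V, ε c = ε c' := fun c c' =>
    LocalFamily.sign_eq_of_isPreconnected (EuclideanSpace ℝ (Fin k)) isOpen_univ hpre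
      (fun x _ => hβcons x) (fun x _ => hβ'cons x) (fun x _ => hβgen x) hε' (mem_univ c) (mem_univ c')
  -- conclude
  rcases isEmpty_or_nonempty ↥V with hVe | ⟨⟨c₀⟩⟩
  · exact ⟨1, fun c => (hVe.false c).elim⟩
  refine ⟨ε c₀, fun c hB => ?_⟩
  have h1 : β' c = (ε c₀ : ℤ) • β c := by rw [← hconst c c₀]; exact hε c (mem_univ c)
  have h2 : βU (e c) = localHomology.xEquiv ℤ ℤ e c k (β' c) := by
    rw [hβ']
    simp only [LinearEquiv.apply_symm_apply]
  have h3 : relativeSingularHomology.map ℤ ℤ (ContinuousMap.id T) hB k w = relLocalFamily w ((e c : ↥U) : T) := by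
    rw [relLocalFamily_apply w (hUB (e c).2)]
    rfl
  have h4 : relLocalFamily w ((e c : ↥U) : T) =
      relativeSingularHomology.map ℤ ℤ (subsetIncl U : C(↥U, T))
        (LocalFamily.mapsTo_compl_pt hjU.injective (e c)) k (βU (e c)) := hβUj (e c)
  rw [h3, h4, h2, h1, map_zsmul]

end Literature.AlgebraicTopology.SingularHomology

end
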